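import Summits.QuantumFields.YangMills.Theorems.IR.AfPincerUcSharpOnsetSuppliers
import HarnessLib

/-!
# Crux `IR` (stmt-QuantumFields-19354), line `af-pincer-Uc`, slot «sharp merge I♯_SC»: owner ruling R107 «Typ SHORT-CHAIN
# TOLERANT is a supplier obligation» TYPED — the literal reading is degenerate (kernel), the insertion reading is not
# (LEAD ym-lead-19354-af-pincer g2)

Helper module for item `stmt-QuantumFields-19354` (`--supports stmt-QuantumFields-19354 --as helper`; it closes nothing).

Owner R107 (ym-beyond-p2 g29, 2026-08-27T13:33:17Z; ctriage-1 O-118.1): at asymptotic-freedom meshes a typical collar CARRIES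
isolated short bad chains, so every supplier of `stub_onsetSharpSC` must NAME its per-cell class `Typ` and make it «short-chain
tolerant — membership invariant under bad chains of length `≤ ℓ₀` (`∃ ℓ₀ ≥ 1, 8·ℓ₀ ≤ b`)», and must state clause-(i) mixing
for collars carrying such chains.  This file types the obligation in two readings and settles which one is usable:

* §1 `LinkTolerant S ℓ₀ A` — the LITERAL reading: the class `A` of configurations is invariant under re-setting ANY `≤ ℓ₀`
  links of `S`.  **Degenerate (PROVED, `eq_empty_or_univ_of_linkTolerant`)**: for `ℓ₀ ≥ 1`, a class read off `S`
  (`DependsOn (· ∈ A) S`, i.e. the format's `TypLocal`) that is link-tolerant on `S` is `∅` or `univ` — single-link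
  re-settings iterate to arbitrary re-settings of `S`.  Consequence for the format (PROVED,
  `univShellCond_of_linkTolerant_format`): if on every mesh-`b` frame the supplier's family is cell-local, link-tolerant with
  some `ℓ₀ ≥ 1`, satisfies clause (i) at every centre and clause (ii) at a budget `δ < 1`, then the UNIVERSAL currency
  `OnsetFormats.UnivShellCond ρ β b n ε` holds — so such a supplier has proved the universal sharp onset and is exposed to
  `OnsetWire.UniformWire` by name (`SharpOnset.not_univOnsetSharpSC_of_uniformWire`).  R107(b) must therefore NOT be read
  as literal invariance.
* §2 `InsertionTolerant ρ w θ R ℓ₀ Typ` — the INSERTION reading (the LEAD's candidate typed form of R107(b)): for every cell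
  `c`, every `U ∈ Typ c` and every set `P` of `≤ ℓ₀` links of the cell whose `R`-neighbourhood is `θ`-CLEAN in `U` (all
  plaquettes touching links of the cell within sup-distance `R` of `P` have `plaqAction ≤ θ`), every `V` agreeing with `U`
  off `P` lies in `Typ c`.  Not iterable at the same spot (after the insertion the neighbourhood is no longer clean) but
  iterable at far-apart spots — so `Typ` contains «a configuration of the class plus any sparse family of short bad chains
  inserted into clean regions», which is the population O-118.1 says a typical collar carries.  `LinkTolerant ⇒ InsertionTolerant`
  (`insertionTolerant_of_linkTolerant`), `univ` is insertion tolerant; the parameters `(θ, R, ℓ₀)` are the supplier's to name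
  (R107: `1 ≤ ℓ₀`, `8 ℓ₀ ≤ b`; ctriage-1's located guard is `R = 8 ℓ₀`).

HONEST FRAMING: a typed supplier discipline and one degeneracy lemma around ONE open stub of a CONDITIONAL chain
(Track A 0/28 UV); nothing here proves weak-coupling mixing or a gap; not Clay.  No `sorry`; axioms ⊆ {propext,
Classical.choice, Quot.sound}.
-/

set_option autoImplicit false

noncomputable section

open MeasureTheory
open Literature.MathematicalPhysics.QuantumFieldTheory hiding ZdEdge
open Literature.MathematicalPhysics.QuantumLattice
open Literature.Probability.LatticeModels (Site)
open Summit.QuantumFields.YangMills.Cruxes.IR.Tempered (cellEdges)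
open Summit.QuantumFields.YangMills.Theorems.OddTorusChessboard (plaqAction)
open Summit.QuantumFields.YangMills.Cruxes.IR.OnsetFormats (UnivShellCond)

namespace Summit.QuantumFields.YangMills.Cruxes.IR.AfPincerUc.SharpLanes

open Summit.QuantumFields.YangMills.Cruxes.IR.AfPincerUc

/-! ## §1 The literal reading `LinkTolerant` and its degeneracy -/
section Literal

variable {G : Type}

/-- **R107(b), LITERAL reading.**  A class `A` of lattice gauge configurations is `ℓ₀`-LINK-TOLERANT on the link set `S` if
membership is invariant under re-setting any `≤ ℓ₀` links of `S` (everything else fixed). -/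
def LinkTolerant (S : Finset (ZdEdge 4)) (ℓ₀ : ℕ) (A : Set (LGConfig 4 G)) : Prop :=
  ∀ U ∈ A, ∀ P : Finset (ZdEdge 4), P ⊆ S → P.card ≤ ℓ₀ →
    ∀ V : LGConfig 4 G, (∀ e, e ∉ P → V e = U e) → V ∈ A

/-- Link tolerance is monotone in `ℓ₀` downward. [arithmetic] -/
theorem LinkTolerant.mono {S : Finset (ZdEdge 4)} {ℓ₀ ℓ₁ : ℕ} {A : Set (LGConfig 4 G)} (h : LinkTolerant S ℓ₀ A)
    (hle : ℓ₁ ≤ ℓ₀) : LinkTolerant S ℓ₁ A :=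
  fun U hU P hP hcard V hV => h U hU P hP (hcard.trans hle) V hV

/-- **DEGENERACY of the literal reading (PROVED).**  For `ℓ₀ ≥ 1`, a class read off `S` that is `ℓ₀`-link-tolerant on `S` is
empty or everything: starting from `U ∈ A`, re-set the links of `S` one at a time to reach any `V` restricted to `S`, then use
that membership depends on `S` only. -/
theorem eq_empty_or_univ_of_linkTolerant {S : Finset (ZdEdge 4)} {ℓ₀ : ℕ} (hℓ₀ : 1 ≤ ℓ₀) {A : Set (LGConfig 4 G)}
    (htol : LinkTolerant S ℓ₀ A) (hdep : DependsOn (fun σ : LGConfig 4 G => σ ∈ A) (↑S : Set (ZdEdge 4))) :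
    A = ∅ ∨ A = Set.univ := by
  classical
  rcases Set.eq_empty_or_nonempty A with h | ⟨U, hU⟩
  · exact Or.inl h
  refine Or.inr (Set.eq_univ_of_forall fun V => ?_)
  -- splice `V` into `U` on a growing subset `T ⊆ S`
  have key : ∀ T : Finset (ZdEdge 4), T ⊆ S → (fun e => if e ∈ T then V e else U e) ∈ A := by
    intro T
    induction T using Finset.induction_on with
    | empty => intro _; simpa using hU
    | @insert a T ha ih =>
      intro hsub
      have hT : T ⊆ S := fun e he => hsub (Finset.mem_insert_of_mem he)
      have haS : a ∈ S := hsub (Finset.mem_insert_self a T)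
      refine htol _ (ih hT) {a} (Finset.singleton_subset_iff.2 haS) (by simpa using hℓ₀) _ ?_
      intro e he
      have hne : e ≠ a := by simpa using he
      simp [Finset.mem_insert, hne]
  have hS := key S subset_rfl
  have hagree : ∀ e ∈ (↑S : Set (ZdEdge 4)), V e = (fun e => if e ∈ S then V e else U e) e := by
    intro e he
    simp [Finset.mem_coe.1 he]
  exact (hdep hagree).mpr hS

/-- **Degeneracy for cell-local families (PROVED):** a `TypLocal` family all of whose cells are `ℓ₀`-link-tolerant on their
own edges (`ℓ₀ ≥ 1`) has every `Typ c ∈ {∅, univ}`. -/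
theorem typ_eq_empty_or_univ_of_linkTolerant {w : Fin 4 → ℤ → ℤ} {Typ : (Fin 4 → ℤ) → Set (LGConfig 4 G)}
    [MeasurableSpace G] (hloc : TypLocal w Typ) {ℓ₀ : ℕ} (hℓ₀ : 1 ≤ ℓ₀)
    (htol : ∀ c, LinkTolerant (cellEdges w c) ℓ₀ (Typ c)) (c : Fin 4 → ℤ) :
    Typ c = ∅ ∨ Typ c = Set.univ :=
  eq_empty_or_univ_of_linkTolerant hℓ₀ (htol c) (hloc.2 c)

end Literal

/-! ### Consequence for the format: a link-tolerant supplier has proved the UNIVERSAL currency -/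
section Collapse

variable {G : Type} [Group G] [TopologicalSpace G] [IsTopologicalGroup G] [CompactSpace G]
  [MeasurableSpace G] [BorelSpace G] [SecondCountableTopology G]

omit [SecondCountableTopology G] in
/-- Clause (i) at every centre for the family `≡ univ` on a mesh-`b` frame IS the universal shell condition's clause for that
frame (definitional, via `shiftFrame w 0 = w`). -/
theorem univClause_of_clauseIAll_univ {N : ℕ} {ρ : G →* Matrix (Fin N) (Fin N) ℂ} {β : ℝ} {w : Fin 4 → ℤ → ℤ}
    {n : ℕ} {ε : ℝ} {Typ : (Fin 4 → ℤ) → Set (LGConfig 4 G)} (huniv : ∀ c, Typ c = Set.univ)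
    (hI : ClauseIAll ρ β w n ε Typ) :
    ∀ Y : Finset (Fin 4 → ℤ), Y ⊆ Tempered.windowCells n → (0 : Fin 4 → ℤ) ∈ Y →
      ∀ σ σ' : LGConfig 4 G,
        (∀ c ∈ ShellTempered.windowCellsPlus n, c ∉ Y → c ∈ Tempered.windowCells n →
          ∀ e ∈ cellEdges w c, σ e = σ' e) →
        ∀ f : LGConfig 4 G → ℝ, IsCylinder f (cellEdges w 0) → Measurable f → (∀ U, 0 ≤ f U ∧ f U ≤ 1) →
          |(∫ U, f U ∂(ymSpecification ρ β (Tempered.regionEdges w Y) σ)) -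
            ∫ U, f U ∂(ymSpecification ρ β (Tempered.regionEdges w Y) σ')| ≤ ε := by
  intro Y hY h0 σ σ' hagree f hf hfm hf01
  have h := hI 0
  rw [OnsetFormatsUc.shiftFrame_zero] at h
  refine h Y hY h0 σ σ' (fun c _ _ => ?_) hagree f hf hfm hf01
  simp only [add_zero, huniv c]
  exact ⟨Set.mem_univ _, Set.mem_univ _⟩

/-- **COLLAPSE (PROVED): a supplier whose per-frame families are cell-local, `ℓ₀`-link-tolerant (`ℓ₀ ≥ 1`), satisfy clause (i)
at every centre and clause (ii) in UKP form at a budget `δ < 1`, has proved `OnsetFormats.UnivShellCond ρ β b n ε`.**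
(Clause (ii) at `δ < 1` makes every `Typ c` nonempty — `Port.typ_nonempty_of_clauseII` — hence `= univ` by §1; clause (i) for
`≡ univ` is the universal clause.)  So the LITERAL reading of R107(b) sends every I♯_SC supplier into the universal currency,
exposed to `OnsetWire.UniformWire` (`SharpOnset.not_univOnsetSharpSC_of_uniformWire`). -/
theorem univShellCond_of_linkTolerant_format {N : ℕ} {ρ : G →* Matrix (Fin N) (Fin N) ℂ} (hρ : Continuous ρ)
    {β : ℝ} {b n : ℕ} {ε δ : ℝ} (hδ : δ < 1)
    (h : ∀ w : Fin 4 → ℤ → ℤ, IsFrame b w →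
      ∃ Typ : (Fin 4 → ℤ) → Set (LGConfig 4 G), TypLocal w Typ ∧
        (∃ ℓ₀ : ℕ, 1 ≤ ℓ₀ ∧ ∀ c, LinkTolerant (cellEdges w c) ℓ₀ (Typ c)) ∧
        ClauseIAll ρ β w n ε Typ ∧ ClauseIIukp ρ β w δ Typ) :
    UnivShellCond ρ β b n ε := by
  intro w hw
  obtain ⟨Typ, hloc, ⟨ℓ₀, hℓ₀, htol⟩, hI, hII⟩ := h w hw
  have huniv : ∀ c, Typ c = Set.univ := fun c => by
    rcases typ_eq_empty_or_univ_of_linkTolerant hloc hℓ₀ htol c with he | hu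
    · exact absurd he (Port.typ_nonempty_of_clauseII hρ hII hδ c).ne_empty
    · exact hu
  exact univClause_of_clauseIAll_univ huniv hI

end Collapse

/-! ## §2 The insertion reading `InsertionTolerant` (non-degenerate; the LEAD's candidate typed form of R107(b)) -/
section Insertion

variable {G : Type} [Group G]

/-- The links of the cell `c` of the frame `w` within sup-distance `R` (on base sites) of some link of `P`. -/
def nearLinks (w : Fin 4 → ℤ → ℤ) (c : Fin 4 → ℤ) (P : Finset (ZdEdge 4)) (R : ℕ) : Finset (ZdEdge 4) :=
  by
    classical
    exact (cellEdges w c).filter fun e' => ∃ e ∈ P, ∀ k : Fin 4, |e'.1 k - e.1 k| ≤ (R : ℤ)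

/-- `nearLinks ⊆ cellEdges`. -/
theorem nearLinks_subset (w : Fin 4 → ℤ → ℤ) (c : Fin 4 → ℤ) (P : Finset (ZdEdge 4)) (R : ℕ) :
    nearLinks w c P R ⊆ cellEdges w c := by
  classical
  intro e he
  unfold nearLinks at he
  exact (Finset.mem_filter.1 he).1

/-- **R107(b), INSERTION reading.**  The family `Typ` is `(θ, R, ℓ₀)`-INSERTION-TOLERANT on the frame `w` (for the
action `plaqAction ρ`): for every cell `c`, every `U ∈ Typ c`, every set `P` of at most `ℓ₀` links of the cell whose
`R`-neighbourhood is `θ`-clean in `U` (every plaquette touching a link of the cell within sup-distance `R` of `P` has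
`plaqAction ρ q U ≤ θ`), and every `V` agreeing with `U` off `P`: `V ∈ Typ c`.  I.e. inserting ONE arbitrary (possibly
maximally frustrated) short chain into a clean spot never expels a configuration from the class; iterating at pairwise far
spots, the class contains its members decorated by any sparse family of short bad chains. -/
def InsertionTolerant {N : ℕ} (ρ : G →* Matrix (Fin N) (Fin N) ℂ) (w : Fin 4 → ℤ → ℤ) (θ : ℝ) (R ℓ₀ : ℕ)
    (Typ : (Fin 4 → ℤ) → Set (LGConfig 4 G)) : Prop :=
  ∀ (c : Fin 4 → ℤ), ∀ U ∈ Typ c, ∀ P : Finset (ZdEdge 4), P ⊆ cellEdges w c → P.card ≤ ℓ₀ →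
    (∀ q ∈ plaquettesTouching (nearLinks w c P R), plaqAction ρ q U ≤ θ) →
      ∀ V : LGConfig 4 G, (∀ e, e ∉ P → V e = U e) → V ∈ Typ c

/-- The literal reading implies the insertion reading (drop the cleanliness premise). -/
theorem insertionTolerant_of_linkTolerant {N : ℕ} (ρ : G →* Matrix (Fin N) (Fin N) ℂ) {w : Fin 4 → ℤ → ℤ}
    (θ : ℝ) (R : ℕ) {ℓ₀ : ℕ} {Typ : (Fin 4 → ℤ) → Set (LGConfig 4 G)}
    (h : ∀ c, LinkTolerant (cellEdges w c) ℓ₀ (Typ c)) : InsertionTolerant ρ w θ R ℓ₀ Typ :=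
  fun c U hU P hP hcard _ V hV => h c U hU P hP hcard V hV

/-- The family `≡ univ` is insertion tolerant (so the notion does not by itself force the universal currency: `univ` is
merely allowed, not implied — contrast §1). -/
theorem insertionTolerant_univ {N : ℕ} (ρ : G →* Matrix (Fin N) (Fin N) ℂ) (w : Fin 4 → ℤ → ℤ) (θ : ℝ) (R ℓ₀ : ℕ) :
    InsertionTolerant ρ w θ R ℓ₀ (fun _ => (Set.univ : Set (LGConfig 4 G))) :=
  fun _ _ _ _ _ _ _ _ _ => Set.mem_univ _

/-- Insertion tolerance is monotone: fewer links (`ℓ₁ ≤ ℓ₀`), a larger guard radius (`R ≤ R'`) and a smaller cleanliness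
threshold (`θ' ≤ θ`) are all easier. [arithmetic] -/
theorem InsertionTolerant.mono {N : ℕ} {ρ : G →* Matrix (Fin N) (Fin N) ℂ} {w : Fin 4 → ℤ → ℤ} {θ θ' : ℝ}
    {R R' ℓ₀ ℓ₁ : ℕ} {Typ : (Fin 4 → ℤ) → Set (LGConfig 4 G)} (h : InsertionTolerant ρ w θ R ℓ₀ Typ)
    (hθ : θ' ≤ θ) (hR : R ≤ R') (hℓ : ℓ₁ ≤ ℓ₀) : InsertionTolerant ρ w θ' R' ℓ₁ Typ := by
  classical
  intro c U hU P hP hcard hclean V hV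
  refine h c U hU P hP (hcard.trans hℓ) (fun q hq => ?_) V hV
  have hsub : nearLinks w c P R ⊆ nearLinks w c P R' := by
    intro e he
    unfold nearLinks at he ⊢
    rcases Finset.mem_filter.1 he with ⟨hec, e₀, he₀, hd⟩
    exact Finset.mem_filter.2 ⟨hec, e₀, he₀, fun k => (hd k).trans (by exact_mod_cast hR)⟩
  have hq' : q ∈ plaquettesTouching (nearLinks w c P R') := by
    rw [mem_plaquettesTouching_iff] at hq ⊢
    obtain ⟨e, he⟩ := hq
    exact ⟨e, Finset.mem_inter.2 ⟨(Finset.mem_inter.1 he).1, hsub (Finset.mem_inter.1 he).2⟩⟩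
  exact (hclean q hq').trans hθ

end Insertion

end Summit.QuantumFields.YangMills.Cruxes.IR.AfPincerUc.SharpLanes

end
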